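import Summits.QuantumFields.YangMills.Theorems.BalabanUVNodesN07Lemma1CrossingBondsTwoBlocks
import Summits.QuantumFields.YangMills.Theorems.BalabanUVNodesN07NormalisationTopRows
import Summits.QuantumFields.YangMills.Theorems.BalabanUVNodesN07RadialGaugeWithinBlock
import Summits.QuantumFields.YangMills.Theorems.BalabanUVNodesN07RadialAxialTower
import Summits.QuantumFields.YangMills.Theorems.BalabanUVNodesN07DataDownTheTowerBlowDown
import HarnessLib

/-!
# N07 [B11] (= [15] = [Balaban1985Variational]) Sect. F — THE CHART's DATUM `B` UNDER THE NORMALISED GAUGE, **DENT ROWS** (print's (160), second case «we apply the Lemma 1 of [6] … the set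
# Λ′ = B(x) ∪ B(x′)»): for a level-`(j−1)` constraint bond of print's local family `D″` lying in the blocks of a DENT PAIR `x, x′ = x + e_μ` of the chart's top box,
# `‖log 𝒜_{j−1}(U^u)(b)‖ ≤ 2·((d−1)nδ̂ + 7t₂ + (d+1)(L−1)τ_rad)` — modulo the top-box letter `δ̂` («(7) for V», supplied by MODULE 69b) and ONE displayed letter `a` = the level-`(j−1)` plaquettes of
# `M^{j−1}U` based in the TWO blocks (print's «α₀ = L²ε₁», the (k−1)-data on the dent) — the two-block Lemma 1 of MODULE 70 (LOCATED-THIRD-BLOCK cured) and a SHARP-HULL radial within-block letter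

Cell `pub-ymgap`, seat `pub-ymgap-dag-n07-e` g24 (FAN-OUT §N07 row s3; LANE OWNER of the K0 road), MODULE 71 (OUTWARD-MEET-EDITION-SPEC §10 (C1b), §11).  `--kind proof --supports
stmt-QuantumFields-20541 --as helper` (K0⁷); count-neutral; def-free.  [15] = [Balaban1985Variational]; [6] = [Balaban1985RegularSpaces]; [3] = [Balaban1985Averaging]; [B5] =
[Balaban1984PropagatorsI]; [4] = [Balaban1984PropagatorsII].

WHY.  MODULE 62 (`…N07NormalisationTopRows`) typed the TOP rows of the chart's datum `B c = log 𝒜_{j}(U^u)(c)` under `NrmOfRecord` modulo `δ̂`; MODULE 69b supplied `δ̂`.  The NEAR class of the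
head's HCHART-MEET-NORM also contains the level-`(j−1)` bonds under the DENT `□_j ∖ Ω_j` (SPEC §10: LOCATED-DENT-ROWS).  Print ([15] p. 303): «If ⟨x,x′⟩ ⊂ □̃′_k then we apply the Lemma 1 of
[6]. We consider the set Λ′ = B(x) ∪ B(x′), and the assumptions of this lemma are satisfied for V = V″ = V₁ with α₀ = L²ε₁, α₁ = |x − y|2L²ε₁. The lemma implies |V₁(x₁,x′₁) − 1| < 4d²L²ε₁ +
|x − y|2L²ε₁ for ⟨x₁, x′₁⟩ ⊂ B(x) ∪ B(x′)».  In the tree's letters (MODULES 60∕61): `𝒜_{j−1}(U^u)(b) = M^{j−1}(U″)(b)`, `U″ = (U^w)^{h̄}`, `w` the residual RADIAL axialiser, `h` the data's coarse axial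
gauge on the top box; `U″` keeps the radial tower (dag-n07-w6 `radialTower_gaugeAct_blockLift`) and its top average is `(M^j U)^h` (`iter_gaugeAct_blockLift` + residual), whose box bonds are
`(d−1)nδ̂`-small (MODULE 40) — print's `α₁`.  The crossing step is [6] Lemma 1 — here MODULE 70's TWO-BLOCK edition (`dist1_crossingBond_iter_le_of_succ_twoBlocks`), so NO plaquette under a core
block is read (LOCATED-THIRD-BLOCK); the within-block letter is dag-n07-w5's radial letter, here re-proved with the SHARP hull (plaquettes with all corners in the block, §1) for the same
reason.  The plaquette letter `a` on the two blocks is DISPLAYED (`hA`, on `M^{j−1}U` — gauge-invariantly the same for `U″`); for a dent pair (both blocks off `Ω_j`, in `Ω_{j−1}`) it is the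
(j−1)-data's (7) (MODULE 69a's non-touching analysis one level down; supplier = the next file).  ⚑ LOCATED-DENT-BOUNDARY (SPEC §11): the near-class bonds from a boundary dent block of `□_j`
into an `Ω_j`-block OUTSIDE `□_j` are NOT dent pairs — their `a` would read plaquettes under `Ω_j` (not data); this file is silent about them (the head's class edition (e3)∕(e4) sends them far).

WHAT IS PROVED (sorry-free; no definition; axioms standard; by-name composition — NOTHING of [15]∕[6]∕[3] analysis beyond MODULES 68∕70's crude Prop. 1 ∕ Lemma 1).
§1 (generic `P`, `G`; standing range; `L < N_m`) ★★ `dist1_le_of_axialGauge_radial_box` — the within-block letter in the radial axial gauge with the SHARP hull: `AxialGauge (radialContourData P m G) W`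
and `PlaqSmallOn (boxPlaqs (L·t) (L·t + (L−1))) a W` (plaquettes with all four corners in `B(castSite t)`) ⇒ `dist1 (W b) ≤ (d(L−1)+1)·((d−1)(L−1)·a)` for every bond with both ends in the block
(dag-n07-w5's `N07RadialGaugeWithinBlock.dist1_le_of_axialGauge_radial` asks the plaquettes with SOURCE in the block — one layer into the neighbours; same proof, pv26's box gauge read on the block's
own `boxPlaqs`); `boxPlaqs_mono`.
§2 (`F`-level, any representative `U′` with the level-`m` radial gauge) ★★ `dist1_iter_crossing_le_of_twoBlocks` — for a crossing bond `b` from `B(castSite t)` to `B(castSite (t + e_μ))`: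
`dist1 (M^m U′ b) ≤ α + 7t₂ + (d+1)(L−1)τ_rad`, `τ_rad = (d(L−1)+1)(d−1)(L−1)·a`, from `PlaqSmallOn (boxPlaqs (L·t) (L·(t+e_μ)+(L−1))) a (M^m U′)` and `dist1 (M^{m+1}U′ ⟨castSite t, μ⟩) ≤ α`
(MODULE 70 §3 + §1); ★ `dist1_iter_within_le_of_box` (within-block: `≤ τ_rad`).
§3 AT THE RECORD under `NrmOfRecord F N Mc ρ … u A` (`j = m + 1`, `Adm22 D″ R M_b`, `2L ≤ R·M_b + 1`): ★★★ `NrmOfRecord.norm_mlog_shearedAvgIter_dent_crossing_le` — for a `D″`-LamBond `b` of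
level `m` crossing from `B(castSite t)` to `B(castSite (t + e_μ))` whose parent `⟨castSite t, μ⟩` is a box bond of the chart's top box `[sqLo_j − 1, sqHi_j + 1]`:
`‖log 𝒜_m(U^u)(b)‖ ≤ 2·((d−1)·n·δ̂ + 7t₂ + (d+1)(L−1)τ_rad)` modulo `δ̂` (top box, as MODULE 62) and `a` (two blocks, DISPLAYED), guards `0 < a`, `2L < N_m`, MODULE 68's `δ_N`-guard, and the
log's range `(d−1)nδ̂ + 7t₂ + (d+1)(L−1)τ_rad ≤ ½`; ★★ `NrmOfRecord.norm_mlog_shearedAvgIter_dent_within_le` (both ends in one block: `≤ 2τ_rad`).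

HONEST SCOPE.  Count-neutral; `NrmOfRecord`, `Adm22`, `δ̂`, `a`, the box numerics and the guards are HYPOTHESES; which level-`(j−1)` LamBonds are dent pairs, the supplier of `a` from the
(j−1)-data, the boundary bonds of LOCATED-DENT-BOUNDARY, the COLLAR far rows ((145)–(146), (155)) and the chart's (154)–(159) assembly are NOT here; HS3NORM ∕ HCHART-MEET-NORM ∕ HBUDGET-NORM stay
displayed in the knit; K0⁷ ∕ K1⁹ NOT closed; N07 NOT discharged; counts unmoved (typed 28∕28 · discharged 5∕27); one finite 𝕋⁴ programme at fixed ε — the route closes the conditional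
finite-𝕋⁴ rung `BalabanLadder.UV` ONLY; the YM mass gap (Clay) is NOT proved by any of this; nothing continuum ∕ ℝ⁴ ∕ OS.  No `sorry`, no `def`, no `instance`, no `notation`.

References: [15] (147) p. 301, (154) p. 302, (160) p. 303 (second case); [6] (1.14)–(1.15) p. 78, Lemma 1 (1.24)–(1.25) p. 79, p. 80 l. 1–4; [3] (21) p. 21, (88) p. 31; [B5] (1.7) p. 18;
[4] (2.1)–(2.3) p. 224.
-/

set_option autoImplicit false

noncomputable section
open scoped BigOperators Matrix.Norms.L2Operator

namespace Summit.QuantumFields.YangMills.BalabanUVNodes.N07DentRowsTwoBlocks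

open Literature.MathematicalPhysics.QuantumFieldTheory.Balaban1983to89
open Literature.MathematicalPhysics.QuantumFieldTheory.Balaban1983to89.Node00
open T4Continuum (T4Family)
open T4AxialGaugeSmallField (castSite castSite_apply castSite_add_e boxBonds boxPlaqs axialGauge dist1_gaugeAct_axialGauge_le_of_mem_boxBonds)
open B7Prop1Explicit (e e_apply)
open B14DomainGeom (Pt)
open B8Eq131Cubes (sqLo sqHi)
open GaugeField (gaugeAct plaqHol)
open ExpMeanLog (expMeanLogSU deltaSU)
open B12GaugeOrbits021 (IsResidual iter_gaugeAct_of_isResidual)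
open B15Eq177GaugeInvariance (blockLift)
open MatrixLog (mlog norm_mlog_le_two_mul)
open Summit.QuantumFields.Balaban3D.Carriers (radialContourData radialHol radialBonds radialHol_gaugeAct)
open Summit.QuantumFields.YangMills.Theorems.FlatCubeOpsText (Adm22)
open Summit.QuantumFields.YangMills.BalabanUVNodes.N07NormalisationOfRecord (NrmOfRecord)
open Summit.QuantumFields.YangMills.BalabanUVNodes.N07NormalisationCrossingEnds (NrmOfRecord.exists_rep_bondIdx)
open Summit.QuantumFields.YangMills.BalabanUVNodes.N09AxialSelectionExists (iter_gaugeAct_blockLift)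
open Summit.QuantumFields.YangMills.BalabanUVNodes.N07DataAxialTopBox (dist1_dataAxial_le)
open Summit.QuantumFields.YangMills.BalabanUVNodes.N07ShearSizeTopBox (mem_boxBonds_of_ends_mem_box)
open Summit.QuantumFields.YangMills.BalabanUVNodes.N07AveragedPlaquetteCornerBlocks (mem_blowDown_of_blockOf_mem_box)
open Summit.QuantumFields.YangMills.BalabanUVNodes.N07Lemma1CrossingBondsTwoBlocks (dist1_crossingBond_iter_le_of_succ_twoBlocks)
open Summit.QuantumFields.YangMills.BalabanUVNodes.N07RadialGaugeWithinBlock (dist1_radialHol_le blockOf_tgt_of_mem_radialBonds)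
open Summit.QuantumFields.YangMills.BalabanUVNodes.N07RadialAxialTower (radialTower_gaugeAct_blockLift)
open Summit.QuantumFields.YangMills.BalabanUVNodes.N07DataDownTheTower (exists_coarse_of_crossing)
open Summit.QuantumFields.YangMills.BalabanUVNodes.N07DataDownTheTowerBlowDown (dist1_plaqHol_iter_gaugeAct)

/-! ## §1  The within-block letter in the radial axial gauge, SHARP hull -/

section Radial

variable {P : Params} {m : ℕ} {G : Type*} [GaugeGroup G]

/-- Monotonicity of pv26's `boxPlaqs` in the box. [folklore] -/
theorem boxPlaqs_mono {j : ℕ} {lo hi lo' hi' : Fin P.d → ℤ} (hlo : lo ≤ lo') (hhi : hi' ≤ hi) :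
    (boxPlaqs lo' hi' : Set (Plaq P j)) ⊆ boxPlaqs lo hi := by
  rintro q ⟨z, h1, h2, h3⟩
  exact ⟨z, le_trans hlo h1, le_trans h2 hhi, h3⟩

/-- ★★ **THE WITHIN-BLOCK LETTER IN THE RADIAL AXIAL GAUGE, SHARP HULL** ([6] pp. 79–80 «|V′_b − 1| < (d−1)(L−1)·…» in the crude conjugation edition of dag-n07-w5's
`dist1_le_of_axialGauge_radial`, with the hypothesis read on the plaquettes whose four corners lie in the block): if `W` is axial for the contours `Γ_{y,x}` of [B5] (1.7) and every level-`m` plaquette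
based in the box `[L·t, L·t + (L−1)]` of the block `B(castSite t)` is within `a` of `1` (`0 ≤ a`, `L < N_m`), then every bond with both ends in the block satisfies
`dist1 (W b) ≤ (d(L−1)+1)·((d−1)(L−1)·a)` — pv26's box gauge `G` on the block (every box bond `(d−1)(L−1)a`-close), the gauge `g = G(centre)⁻¹·G` trivial at the centre, `g(x)⁻¹ = (W^g)(Γ_{y,x})`
by the axial gauge, and `W b = g(b₋)⁻¹(W^g b)g(b₊)`. [cite: Balaban1985RegularSpaces, (1.15) p.78, pp.79–80 (proof of Lemma 1); Balaban1984PropagatorsI, (1.7) p.18] -/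
theorem dist1_le_of_axialGauge_radial_box (hm : m + 1 ≤ P.m + P.K) (W : GaugeField P m G)
    (hW : AxialGauge (radialContourData P m G) W) {a : ℝ} (ha : 0 ≤ a) (hN : P.L < P.sitesPerDir m) (t : Fin P.d → ℤ)
    (hplaq : PlaqSmallOn (boxPlaqs (fun i => (P.L : ℤ) * t i) (fun i => (P.L : ℤ) * t i + ((P.L : ℤ) - 1))) a W)
    (b : PBond P m) (hsrc : blockOf b.src = (castSite t : Site P (m + 1))) (htgt : blockOf b.tgt = (castSite t : Site P (m + 1))) :
    dist1 (W b) ≤ ((P.d * (P.L - 1) + 1 : ℕ) : ℝ) * ((((P.d - 1 : ℕ) : ℝ) * ((P.L - 1 : ℕ) : ℝ)) * a) := by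
  classical
  set lo : Fin P.d → ℤ := fun i => (P.L : ℤ) * t i with hlo
  set hi : Fin P.d → ℤ := fun i => (P.L : ℤ) * t i + ((P.L : ℤ) - 1) with hhi
  set y : Site P (m + 1) := castSite t with hy
  set Gy : GaugeTransf P m G := axialGauge W lo hi with hGy
  set g : GaugeTransf P m G := fun x => (Gy (emb y))⁻¹ * Gy x with hg
  set τ : ℝ := ((P.d - 1 : ℕ) : ℝ) * ((P.L - 1 : ℕ) : ℝ) * a with hτdef
  have hτ : 0 ≤ τ := by positivity
  have hL1 : 1 ≤ P.L := P.L_pos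
  -- box numerics: one block, `L` labels per direction, non-wrapping
  have hn : ∀ κ, hi κ ≤ lo κ + ((P.L - 1 : ℕ) : ℤ) := fun κ => by
    simp only [hhi, hlo]; push_cast [Nat.cast_sub hL1]; linarith
  have hnN : P.L - 1 < P.sitesPerDir m := by omega
  have hN' : ∀ κ, hi κ + 1 - lo κ < P.sitesPerDir m := fun κ => by
    simp only [hhi, hlo]
    have : (P.L : ℤ) < (P.sitesPerDir m : ℤ) := by exact_mod_cast hN
    linarith
  -- the bonds with both ends in `B(y)` are box bonds
  have hbox : ∀ b' : PBond P m, blockOf b'.src = y → blockOf b'.tgt = y → b' ∈ boxBonds lo hi := by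
    intro b' h1 h2
    have hs : b'.src ∈ (castSite '' Set.Icc lo hi : Set (Site P m)) := by
      have := mem_blowDown_of_blockOf_mem_box hm (⟨t, ⟨le_rfl, le_rfl⟩, h1.symm⟩ : blockOf b'.src ∈ (castSite '' Set.Icc t t : Set (Site P (m + 1))))
      simpa [hlo, hhi] using this
    have ht' : b'.tgt ∈ (castSite '' Set.Icc lo hi : Set (Site P m)) := by
      have := mem_blowDown_of_blockOf_mem_box hm (⟨t, ⟨le_rfl, le_rfl⟩, h2.symm⟩ : blockOf b'.tgt ∈ (castSite '' Set.Icc t t : Set (Site P (m + 1))))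
      simpa [hlo, hhi] using this
    exact mem_boxBonds_of_ends_mem_box hN' hs ht'
  -- every bond of `B(y)` of `W^g` is `τ`-close to `1` (pv26's box gauge, conjugated by the constant `G_y(emb y)`)
  have hWg : ∀ b' : PBond P m, blockOf b'.src = y → blockOf b'.tgt = y → dist1 (gaugeAct g W b') ≤ τ := by
    intro b' h1 h2
    have hconj : gaugeAct g W b' = (Gy (emb y))⁻¹ * gaugeAct Gy W b' * ((Gy (emb y))⁻¹)⁻¹ := by
      show (Gy (emb y))⁻¹ * Gy b'.src * W b' * ((Gy (emb y))⁻¹ * Gy b'.tgt)⁻¹ = (Gy (emb y))⁻¹ * (Gy b'.src * W b' * (Gy b'.tgt)⁻¹) * ((Gy (emb y))⁻¹)⁻¹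
      group
    rw [hconj, GaugeGroup.dist1_conj]
    exact dist1_gaugeAct_axialGauge_le_of_mem_boxBonds W subset_rfl hplaq ha hn hnN (hbox b' h1 h2)
  have hforest : ∀ b' ∈ radialBonds ({y} : Finset (Site P (m + 1))), dist1 (gaugeAct g W b') ≤ τ := fun b' hb' =>
    let h := blockOf_tgt_of_mem_radialBonds hm hb'
    hWg b' h.1 h.2
  have hg1 : g (emb y) = 1 := by show (Gy (emb y))⁻¹ * Gy (emb y) = 1; exact inv_mul_cancel _
  -- `g(x)⁻¹ = (W^g)(Γ_{y,x})`, hence `dist1 (g x) ≤ d·((L−1)∕2)·τ` on `B(y)`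
  have hgx : ∀ x : Site P m, blockOf x = y → dist1 (g x) ≤ (P.d : ℝ) * ((((P.L - 1) / 2 : ℕ) : ℝ) * τ) := by
    intro x hx
    by_cases hxc : x = emb y
    · rw [hxc, hg1, GaugeGroup.dist1_one]; positivity
    · have hax : radialHol W y x = 1 := hW y x hx hxc
      have hcov : radialHol (gaugeAct g W) y x = (g x)⁻¹ := by
        rw [radialHol_gaugeAct, hax, hg1, one_mul, one_mul]
      have h := dist1_radialHol_le hm (gaugeAct g W) hτ hforest hx
      rw [hcov, GaugeGroup.dist1_inv] at h
      exact h
  -- `W b = g(b₋)⁻¹ (W^g b) g(b₊)`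
  have hWb : W b = (g b.src)⁻¹ * gaugeAct g W b * g b.tgt := by
    simp only [gaugeAct, GaugeField.gaugeAct]; group
  have hd2 : (2 : ℝ) * (((P.L - 1) / 2 : ℕ) : ℝ) ≤ ((P.L - 1 : ℕ) : ℝ) := by
    exact_mod_cast (show 2 * ((P.L - 1) / 2) ≤ P.L - 1 from Nat.mul_div_le (P.L - 1) 2)
  rw [hWb]
  calc dist1 ((g b.src)⁻¹ * gaugeAct g W b * g b.tgt)
      ≤ dist1 ((g b.src)⁻¹ * gaugeAct g W b) + dist1 (g b.tgt) := GaugeGroup.dist1_mul_le _ _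
    _ ≤ dist1 ((g b.src)⁻¹) + dist1 (gaugeAct g W b) + dist1 (g b.tgt) := by
        linarith [GaugeGroup.dist1_mul_le (g b.src)⁻¹ (gaugeAct g W b)]
    _ ≤ (P.d : ℝ) * ((((P.L - 1) / 2 : ℕ) : ℝ) * τ) + τ + (P.d : ℝ) * ((((P.L - 1) / 2 : ℕ) : ℝ) * τ) := by
        rw [GaugeGroup.dist1_inv]
        exact add_le_add (add_le_add (hgx _ hsrc) (hWg b hsrc htgt)) (hgx _ htgt)
    _ ≤ ((P.d * (P.L - 1) + 1 : ℕ) : ℝ) * τ := by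
        push_cast
        have hd0 : (0 : ℝ) ≤ P.d := by positivity
        nlinarith [mul_nonneg hd0 hτ]

end Radial

/-! ## §2  A representative with the level-`m` radial gauge: the crossing and within-block bonds of a dent pair -/

section Representative

variable {F : T4Family} {N : ℕ} [NeZero N]

/-- ★ **WITHIN-BLOCK BONDS OF A RADIALLY AXIAL LEVEL** (`F`-level reading of §1): `dist1 (M^m U′ b) ≤ τ_rad(a)` for both ends in `B(castSite t)`, from the plaquettes of `M^m U′` based in the block's box.
[cite: Balaban1985RegularSpaces, (1.15) p.78, pp.79–80] -/
theorem dist1_iter_within_le_of_box {K m : ℕ} (hm : m + 1 ≤ (F.P K).m + (F.P K).K) (U' : GaugeField (F.P K) 0 (SU N))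
    (htower : AxialGauge (radialContourData (F.P K) m (SU N)) (Averaging.iter (avOfRecord F N K) m U'))
    {a : ℝ} (ha : 0 ≤ a) (hN : (F.P K).L < (F.P K).sitesPerDir m) (t : Pt (F.P K).d)
    (hW : PlaqSmallOn (boxPlaqs (fun i => ((F.P K).L : ℤ) * t i) (fun i => ((F.P K).L : ℤ) * t i + (((F.P K).L : ℤ) - 1))) a (Averaging.iter (avOfRecord F N K) m U'))
    (b : PBond (F.P K) m) (hsrc : blockOf b.src = (castSite t : Site (F.P K) (m + 1))) (htgt : blockOf b.tgt = (castSite t : Site (F.P K) (m + 1))) :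
    dist1 (Averaging.iter (avOfRecord F N K) m U' b) ≤
      (((F.P K).d * ((F.P K).L - 1) + 1 : ℕ) : ℝ) * (((((F.P K).d - 1 : ℕ) : ℝ) * (((F.P K).L - 1 : ℕ) : ℝ)) * a) :=
  dist1_le_of_axialGauge_radial_box hm _ htower ha hN t hW b hsrc htgt

/-- ★★ **THE CROSSING BONDS OF A DENT PAIR AT A REPRESENTATIVE** (print's (160) second case, [6] Lemma 1 on `Λ′ = B(x) ∪ B(x′)`): for ANY `U′` whose level-`m` average is radially axial, a
crossing bond `b` from `B(castSite t)` into `B(castSite (t + e_μ))`: `dist1 (M^m U′ b) ≤ α + 7t₂ + (d+1)(L−1)·τ_rad(a)` from the level-`m` plaquettes of `M^m U′` based in the TWO blocks (`< a`)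
and the parent's letter `dist1 (M^{m+1}U′ ⟨castSite t, μ⟩) ≤ α` — MODULE 70 §3 with the within-block letter SUPPLIED by §1 on both blocks.  Guards: `0 < a`, `2L < N_m`, MODULE 68's `δ_N`-guard.
[cite: Balaban1985Variational, (160) p.303; Balaban1985RegularSpaces, Lemma 1 (1.25) p.79, (1.15) p.78] -/
theorem dist1_iter_crossing_le_of_twoBlocks {K m : ℕ} (hm : m + 1 ≤ (F.P K).m + (F.P K).K) (U' : GaugeField (F.P K) 0 (SU N))
    (htower : AxialGauge (radialContourData (F.P K) m (SU N)) (Averaging.iter (avOfRecord F N K) m U'))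
    {a α : ℝ} (ha : 0 < a) (hN : 2 * (F.P K).L < (F.P K).sitesPerDir m)
    (ht : (((((F.P K).d + 2) * (F.P K).L : ℕ) : ℝ) ^ 2 / 4) * ((4 * (((((F.P K).d - 1 : ℕ) : ℝ)) * ((2 * (F.P K).L - 1 : ℕ) : ℝ)) + 1) * a) < deltaSU (Fin N))
    (t : Pt (F.P K).d) (μ : Fin (F.P K).d)
    (hW : PlaqSmallOn (boxPlaqs (fun i => ((F.P K).L : ℤ) * t i) (fun i => ((F.P K).L : ℤ) * (t + e μ) i + (((F.P K).L : ℤ) - 1))) a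
      (Averaging.iter (avOfRecord F N K) m U'))
    (hα : dist1 (Averaging.iter (avOfRecord F N K) (m + 1) U' ⟨castSite t, μ⟩) ≤ α)
    (b : PBond (F.P K) m) (hsrc : blockOf b.src = (castSite t : Site (F.P K) (m + 1))) (hdir : b.dir = μ)
    (htgt : blockOf b.tgt = (castSite (t + e μ) : Site (F.P K) (m + 1))) :
    dist1 (Averaging.iter (avOfRecord F N K) m U' b) ≤
      α + 7 * ((((((F.P K).d + 2) * (F.P K).L : ℕ) : ℝ) ^ 2 / 4) * ((4 * (((((F.P K).d - 1 : ℕ) : ℝ)) * ((2 * (F.P K).L - 1 : ℕ) : ℝ)) + 1) * a)) +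
        ((((F.P K).d + 1) * ((F.P K).L - 1) : ℕ) : ℝ) *
          ((((F.P K).d * ((F.P K).L - 1) + 1 : ℕ) : ℝ) * (((((F.P K).d - 1 : ℕ) : ℝ) * (((F.P K).L - 1 : ℕ) : ℝ)) * a)) := by
  have hL0 : (0 : ℤ) ≤ (F.P K).L := by positivity
  have hL1 : (1 : ℤ) ≤ (F.P K).L := by exact_mod_cast (F.P K).L_pos
  have hN1 : (F.P K).L < (F.P K).sitesPerDir m := by omega
  have he0 : ∀ κ, (0 : ℤ) ≤ e μ κ := fun κ => by rw [e_apply]; split_ifs <;> norm_num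
  -- the within-block letter on both blocks (§1; each block's box lies in the two-block box)
  have hsub₁ : (boxPlaqs (fun i => ((F.P K).L : ℤ) * t i) (fun i => ((F.P K).L : ℤ) * t i + (((F.P K).L : ℤ) - 1)) : Set (Plaq (F.P K) m)) ⊆
      boxPlaqs (fun i => ((F.P K).L : ℤ) * t i) (fun i => ((F.P K).L : ℤ) * (t + e μ) i + (((F.P K).L : ℤ) - 1)) :=
    boxPlaqs_mono le_rfl (fun i => by simp only [Pi.add_apply]; nlinarith [he0 i])
  have hsub₂ : (boxPlaqs (fun i => ((F.P K).L : ℤ) * (t + e μ) i) (fun i => ((F.P K).L : ℤ) * (t + e μ) i + (((F.P K).L : ℤ) - 1)) : Set (Plaq (F.P K) m)) ⊆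
      boxPlaqs (fun i => ((F.P K).L : ℤ) * t i) (fun i => ((F.P K).L : ℤ) * (t + e μ) i + (((F.P K).L : ℤ) - 1)) :=
    boxPlaqs_mono (fun i => by simp only [Pi.add_apply]; nlinarith [he0 i]) le_rfl
  have hτ₁ := fun b' h1 h2 => dist1_iter_within_le_of_box hm U' htower ha.le hN1 t (fun q hq => hW q (hsub₁ hq)) b' h1 h2
  have hτ₂ := fun b' h1 h2 => dist1_iter_within_le_of_box hm U' htower ha.le hN1 (t + e μ) (fun q hq => hW q (hsub₂ hq)) b' h1 h2
  have hshift : ((castSite t : Site (F.P K) (m + 1)).shift μ) = castSite (t + e μ) := (castSite_add_e t μ).symm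
  have hint : ∀ b' : PBond (F.P K) m, blockOf b'.src = blockOf b'.tgt →
      (blockOf b'.src = (castSite t : Site (F.P K) (m + 1)) ∨ blockOf b'.src = (castSite t : Site (F.P K) (m + 1)).shift μ) →
      dist1 (Averaging.iter (avOfRecord F N K) m U' b') ≤
        (((F.P K).d * ((F.P K).L - 1) + 1 : ℕ) : ℝ) * (((((F.P K).d - 1 : ℕ) : ℝ) * (((F.P K).L - 1 : ℕ) : ℝ)) * a) := by
    intro b' hst hb'
    rcases hb' with h | h
    · exact hτ₁ b' h (hst ▸ h)
    · rw [hshift] at h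
      exact hτ₂ b' h (hst ▸ h)
  -- the crossing bond sits on the far face of `B(castSite t)` in the direction `μ`
  have hne : blockOf b.tgt ≠ blockOf b.src := by
    rw [htgt, hsrc, ← hshift]
    intro h
    have h1 := congrFun h μ
    rw [Site.shift_apply, if_pos rfl] at h1
    have h2 : (1 : ZMod ((F.P K).sitesPerDir (m + 1))) = 0 := by linear_combination h1
    exact one_ne_zero h2
  obtain ⟨-, r, hr, hbr⟩ := exists_coarse_of_crossing hm b hne
  rw [hdir] at hr
  have hτ0 : 0 ≤ (((F.P K).d * ((F.P K).L - 1) + 1 : ℕ) : ℝ) * (((((F.P K).d - 1 : ℕ) : ℝ) * (((F.P K).L - 1 : ℕ) : ℝ)) * a) := by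
    have := ha.le; positivity
  have hmain := dist1_crossingBond_iter_le_of_succ_twoBlocks (F := F) (N := N) hm U' ha hτ0 hN ht t μ hW hα hint r hr 1 1
  have hb : b = ⟨Site.blockSite (castSite t : Site (F.P K) (m + 1)) r, μ⟩ := by
    rw [hbr, hsrc, hdir]
  rw [hb]
  exact hmain

end Representative

/-! ## §3  At the record under `NrmOfRecord`: the dent rows of the chart's datum -/

section Record

variable (F : T4Family) (N : ℕ) [NeZero N]

/-- ★★★ **THE DENT CROSSING ROWS OF THE CHART's DATUM `B` — print's (160), second case, at the objects of record**: under the normalisation of record at the datum `(j, idx)`, `j = m + 1`, the (2.2)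
collar of `D″`, the displayed top-box letter `δ̂` («(7) for V» on `[sqLo_j − 1, sqHi_j + 1]`, non-wrapping box of `n + 1` labels) and the displayed TWO-BLOCK letter `a` (the level-`m` plaquettes
of `M^m U` based in `B(castSite t) ∪ B(castSite (t + e_μ))`, print's `α₀ = L²ε₁`): for every `D″`-constraint bond `b` of level `m` crossing from `B(castSite t)` into `B(castSite (t + e_μ))` whose
parent `⟨castSite t, μ⟩` is a box bond of the top box, `‖log 𝒜_m(U^u)(b)‖ ≤ 2·((d−1)·n·δ̂ + 7t₂ + (d+1)(L−1)·τ_rad(a))` — δ-LINEAR in `(δ̂, a)`.  `𝒜_m(U^u)(b) = M^m(U″)(b)` (MODULE 61),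
`U″ = (U^w)^{h̄}` keeps the radial tower (dag-n07-w6) and has top `(M^j U)^h` (`α₁ = (d−1)nδ̂`, MODULE 40); §2.  Guards: `0 < a`, `2L < N_m`, MODULE 68's `δ_N`-guard; log range `… ≤ ½`.
[cite: Balaban1985Variational, (160) p.303, (147) p.301, (154) p.302; Balaban1985RegularSpaces, Lemma 1 (1.25) p.79, (1.15) p.78; Balaban1985Averaging, (21) p.21, (88) p.31; Balaban1984PropagatorsII, (2.1)–(2.3) p.224] -/
theorem NrmOfRecord.norm_mlog_shearedAvgIter_dent_crossing_le {Mc ρ : ℕ} {ν : Stage7Numerics} {M : ℕ} {g : ℕ → ℝ} {K k : ℕ} {s : SeqOfRecord F ν M g K k}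
    {U : GaugeField (F.P K) 0 (SU N)} {m : ℕ} {idx : Pt (F.P K).d} {u : GaugeTransf (F.P K) 0 (SU N)} {A : PBond (F.P K) 0 → MatA N}
    (hN : NrmOfRecord F N Mc ρ ν M g K k s U (m + 1) idx u A) (hk : m + 1 ≤ (F.P K).m + (F.P K).K) {R Mb : ℕ}
    (hAdm : Adm22 (domainsMeet (cubeDomains (F.P K) (cornerP (F.P K) Mc ρ idx) (sideP (F.P K) Mc ρ) ρ (m + 1) hk) (domainsOfSeq s.Ω (m + 1) hk)) R Mb)
    (hRM : 2 * (F.P K).L ≤ R * Mb + 1)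
    -- the top-box letter `δ̂` (as MODULE 62) and the box numerics
    {δ' : ℝ} (hδ : 0 ≤ δ')
    (hV : PlaqSmallOn (boxPlaqs (sqLo (F.P K).L (cornerP (F.P K) Mc ρ idx) ρ (m + 1) (m + 1) - 1)
      (sqHi (F.P K).L (cornerP (F.P K) Mc ρ idx) (sideP (F.P K) Mc ρ) ρ (m + 1) (m + 1) + 1)) δ' (Averaging.iter (avOfRecord F N K) (m + 1) U))
    {n : ℕ} (hn : ∀ κ, (sqHi (F.P K).L (cornerP (F.P K) Mc ρ idx) (sideP (F.P K) Mc ρ) ρ (m + 1) (m + 1) + 1) κ ≤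
      (sqLo (F.P K).L (cornerP (F.P K) Mc ρ idx) ρ (m + 1) (m + 1) - 1) κ + n)
    (hnN : n < (F.P K).sitesPerDir (m + 1))
    -- the dent pair and its two-block letter `a`
    (t : Pt (F.P K).d) (μ : Fin (F.P K).d)
    (hpar : (⟨castSite t, μ⟩ : PBond (F.P K) (m + 1)) ∈ boxBonds (sqLo (F.P K).L (cornerP (F.P K) Mc ρ idx) ρ (m + 1) (m + 1) - 1)
      (sqHi (F.P K).L (cornerP (F.P K) Mc ρ idx) (sideP (F.P K) Mc ρ) ρ (m + 1) (m + 1) + 1))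
    {a : ℝ} (ha : 0 < a) (hNm : 2 * (F.P K).L < (F.P K).sitesPerDir m)
    (ht : (((((F.P K).d + 2) * (F.P K).L : ℕ) : ℝ) ^ 2 / 4) * ((4 * (((((F.P K).d - 1 : ℕ) : ℝ)) * ((2 * (F.P K).L - 1 : ℕ) : ℝ)) + 1) * a) < deltaSU (Fin N))
    (hA : PlaqSmallOn (boxPlaqs (fun i => ((F.P K).L : ℤ) * t i) (fun i => ((F.P K).L : ℤ) * (t + e μ) i + (((F.P K).L : ℤ) - 1))) a
      (Averaging.iter (avOfRecord F N K) m U))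
    (hr : (((F.P K).d - 1 : ℕ) : ℝ) * n * δ' +
        7 * ((((((F.P K).d + 2) * (F.P K).L : ℕ) : ℝ) ^ 2 / 4) * ((4 * (((((F.P K).d - 1 : ℕ) : ℝ)) * ((2 * (F.P K).L - 1 : ℕ) : ℝ)) + 1) * a)) +
        ((((F.P K).d + 1) * ((F.P K).L - 1) : ℕ) : ℝ) *
          ((((F.P K).d * ((F.P K).L - 1) + 1 : ℕ) : ℝ) * (((((F.P K).d - 1 : ℕ) : ℝ) * (((F.P K).L - 1 : ℕ) : ℝ)) * a)) ≤ 1 / 2)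
    -- the bond: a `D″`-constraint bond of level `m` crossing from `B(castSite t)` to `B(castSite (t + e_μ))`
    (b : PBond (F.P K) m)
    (hb : (domainsMeet (cubeDomains (F.P K) (cornerP (F.P K) Mc ρ idx) (sideP (F.P K) Mc ρ) ρ (m + 1) hk) (domainsOfSeq s.Ω (m + 1) hk)).LamBond m b)
    (hsrc : blockOf b.src = (castSite t : Site (F.P K) (m + 1))) (hdir : b.dir = μ) (htgt : blockOf b.tgt = (castSite (t + e μ) : Site (F.P K) (m + 1))) :
    ‖mlog ((shearedAvgIter (avOfRecord F N K) (fun i => radialContourData (F.P K) i (SU N)) (loopAvgBlockOp expMeanLogSU) (gaugeAct u U) m b : SU N) : MatA N)‖ ≤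
      2 * ((((F.P K).d - 1 : ℕ) : ℝ) * n * δ' +
        7 * ((((((F.P K).d + 2) * (F.P K).L : ℕ) : ℝ) ^ 2 / 4) * ((4 * (((((F.P K).d - 1 : ℕ) : ℝ)) * ((2 * (F.P K).L - 1 : ℕ) : ℝ)) + 1) * a)) +
        ((((F.P K).d + 1) * ((F.P K).L - 1) : ℕ) : ℝ) *
          ((((F.P K).d * ((F.P K).L - 1) + 1 : ℕ) : ℝ) * (((((F.P K).d - 1 : ℕ) : ℝ) * (((F.P K).L - 1 : ℕ) : ℝ)) * a))) := by
  set D'' := domainsMeet (cubeDomains (F.P K) (cornerP (F.P K) Mc ρ idx) (sideP (F.P K) Mc ρ) ρ (m + 1) hk) (domainsOfSeq s.Ω (m + 1) hk) with hD''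
  obtain ⟨w, hres, hax, hall⟩ := NrmOfRecord.exists_rep_bondIdx hN hk hAdm hRM
  have hlt : m < D''.k + 1 := by
    show m < min (m + 1) (m + 1) + 1
    rw [min_self]; omega
  have hid := hall ⟨⟨⟨m, hlt⟩, b⟩, hb⟩
  -- the representative `U″ = (U^w)^{h̄}` and its letters
  have hresid : Averaging.iter (avOfRecord F N K) (m + 1) (gaugeAct w U) = Averaging.iter (avOfRecord F N K) (m + 1) U :=
    iter_gaugeAct_of_isResidual (avOfRecord F N K) hk hres U
  set h : GaugeTransf (F.P K) (m + 1) (SU N) := axialGauge (Averaging.iter (avOfRecord F N K) (m + 1) U)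
    (sqLo (F.P K).L (cornerP (F.P K) Mc ρ idx) ρ (m + 1) (m + 1) - 1) (sqHi (F.P K).L (cornerP (F.P K) Mc ρ idx) (sideP (F.P K) Mc ρ) ρ (m + 1) (m + 1) + 1) with hh
  set U'' : GaugeField (F.P K) 0 (SU N) := gaugeAct (blockLift (m + 1) h) (gaugeAct w U) with hU''
  rw [hresid] at hid
  -- (i) `U″` keeps the radial tower; in particular its level-`m` average is radially axial
  have htower : AxialGauge (radialContourData (F.P K) m (SU N)) (Averaging.iter (avOfRecord F N K) m U'') :=
    radialTower_gaugeAct_blockLift F N K hk h (gaugeAct w U) hax m (Nat.lt_succ_self m)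
  -- (ii) the plaquettes of `M^m U″` are those of `M^m U` (gauge invariance, twice)
  have hW : PlaqSmallOn (boxPlaqs (fun i => ((F.P K).L : ℤ) * t i) (fun i => ((F.P K).L : ℤ) * (t + e μ) i + (((F.P K).L : ℤ) - 1))) a
      (Averaging.iter (avOfRecord F N K) m U'') := by
    intro q hq
    have h1 := dist1_plaqHol_iter_gaugeAct (F := F) (N := N) (K := K) (by omega : m ≤ (F.P K).m + (F.P K).K) (blockLift (m + 1) h) (gaugeAct w U) q
    have h2 := dist1_plaqHol_iter_gaugeAct (F := F) (N := N) (K := K) (by omega : m ≤ (F.P K).m + (F.P K).K) w U q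
    rw [hU'', h1, h2]
    exact hA q hq
  -- (iii) the top of `U″` is `(M^j U)^h`: the parent's letter `α₁ = (d−1)nδ̂` (MODULE 40)
  have htop : Averaging.iter (avOfRecord F N K) (m + 1) U'' = gaugeAct h (Averaging.iter (avOfRecord F N K) (m + 1) U) := by
    rw [hU'', iter_gaugeAct_blockLift (avOfRecord F N K) hk h (gaugeAct w U), hresid]
  have hα : dist1 (Averaging.iter (avOfRecord F N K) (m + 1) U'' ⟨castSite t, μ⟩) ≤ (((F.P K).d - 1 : ℕ) : ℝ) * n * δ' := by
    rw [htop, hh]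
    exact dist1_dataAxial_le _ subset_rfl hV hδ hn hnN hpar
  -- (iv) §2 at `U″`, then MODULE 61's identity and the logarithm's Lipschitz bound
  have hrow := dist1_iter_crossing_le_of_twoBlocks hk U'' htower ha hNm ht t μ hW hα b hsrc hdir htgt
  rw [hid]
  exact (norm_mlog_le_two_mul (hrow.trans hr)).trans (mul_le_mul_of_nonneg_left hrow (by norm_num))

/-- ★★ **THE DENT WITHIN-BLOCK ROWS**: the same for a `D″`-constraint bond of level `m` with BOTH ends in `B(castSite t)`: `‖log 𝒜_m(U^u)(b)‖ ≤ 2·τ_rad(a)` from the block's own plaquette letter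
(the radial tower of `U″`; no top letter needed). [cite: Balaban1985Variational, (160) p.303; Balaban1985RegularSpaces, (1.15) p.78, pp.79–80] -/
theorem NrmOfRecord.norm_mlog_shearedAvgIter_dent_within_le {Mc ρ : ℕ} {ν : Stage7Numerics} {M : ℕ} {g : ℕ → ℝ} {K k : ℕ} {s : SeqOfRecord F ν M g K k}
    {U : GaugeField (F.P K) 0 (SU N)} {m : ℕ} {idx : Pt (F.P K).d} {u : GaugeTransf (F.P K) 0 (SU N)} {A : PBond (F.P K) 0 → MatA N}
    (hN : NrmOfRecord F N Mc ρ ν M g K k s U (m + 1) idx u A) (hk : m + 1 ≤ (F.P K).m + (F.P K).K) {R Mb : ℕ}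
    (hAdm : Adm22 (domainsMeet (cubeDomains (F.P K) (cornerP (F.P K) Mc ρ idx) (sideP (F.P K) Mc ρ) ρ (m + 1) hk) (domainsOfSeq s.Ω (m + 1) hk)) R Mb)
    (hRM : 2 * (F.P K).L ≤ R * Mb + 1)
    (t : Pt (F.P K).d) {a : ℝ} (ha : 0 ≤ a) (hNm : (F.P K).L < (F.P K).sitesPerDir m)
    (hA : PlaqSmallOn (boxPlaqs (fun i => ((F.P K).L : ℤ) * t i) (fun i => ((F.P K).L : ℤ) * t i + (((F.P K).L : ℤ) - 1))) a (Averaging.iter (avOfRecord F N K) m U))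
    (hr : (((F.P K).d * ((F.P K).L - 1) + 1 : ℕ) : ℝ) * (((((F.P K).d - 1 : ℕ) : ℝ) * (((F.P K).L - 1 : ℕ) : ℝ)) * a) ≤ 1 / 2)
    (b : PBond (F.P K) m)
    (hb : (domainsMeet (cubeDomains (F.P K) (cornerP (F.P K) Mc ρ idx) (sideP (F.P K) Mc ρ) ρ (m + 1) hk) (domainsOfSeq s.Ω (m + 1) hk)).LamBond m b)
    (hsrc : blockOf b.src = (castSite t : Site (F.P K) (m + 1))) (htgt : blockOf b.tgt = (castSite t : Site (F.P K) (m + 1))) :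
    ‖mlog ((shearedAvgIter (avOfRecord F N K) (fun i => radialContourData (F.P K) i (SU N)) (loopAvgBlockOp expMeanLogSU) (gaugeAct u U) m b : SU N) : MatA N)‖ ≤
      2 * ((((F.P K).d * ((F.P K).L - 1) + 1 : ℕ) : ℝ) * (((((F.P K).d - 1 : ℕ) : ℝ) * (((F.P K).L - 1 : ℕ) : ℝ)) * a)) := by
  set D'' := domainsMeet (cubeDomains (F.P K) (cornerP (F.P K) Mc ρ idx) (sideP (F.P K) Mc ρ) ρ (m + 1) hk) (domainsOfSeq s.Ω (m + 1) hk) with hD''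
  obtain ⟨w, hres, hax, hall⟩ := NrmOfRecord.exists_rep_bondIdx hN hk hAdm hRM
  have hlt : m < D''.k + 1 := by
    show m < min (m + 1) (m + 1) + 1
    rw [min_self]; omega
  have hid := hall ⟨⟨⟨m, hlt⟩, b⟩, hb⟩
  have hresid : Averaging.iter (avOfRecord F N K) (m + 1) (gaugeAct w U) = Averaging.iter (avOfRecord F N K) (m + 1) U :=
    iter_gaugeAct_of_isResidual (avOfRecord F N K) hk hres U
  set h : GaugeTransf (F.P K) (m + 1) (SU N) := axialGauge (Averaging.iter (avOfRecord F N K) (m + 1) U)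
    (sqLo (F.P K).L (cornerP (F.P K) Mc ρ idx) ρ (m + 1) (m + 1) - 1) (sqHi (F.P K).L (cornerP (F.P K) Mc ρ idx) (sideP (F.P K) Mc ρ) ρ (m + 1) (m + 1) + 1) with hh
  set U'' : GaugeField (F.P K) 0 (SU N) := gaugeAct (blockLift (m + 1) h) (gaugeAct w U) with hU''
  rw [hresid] at hid
  have htower : AxialGauge (radialContourData (F.P K) m (SU N)) (Averaging.iter (avOfRecord F N K) m U'') :=
    radialTower_gaugeAct_blockLift F N K hk h (gaugeAct w U) hax m (Nat.lt_succ_self m)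
  have hW : PlaqSmallOn (boxPlaqs (fun i => ((F.P K).L : ℤ) * t i) (fun i => ((F.P K).L : ℤ) * t i + (((F.P K).L : ℤ) - 1))) a
      (Averaging.iter (avOfRecord F N K) m U'') := by
    intro q hq
    have h1 := dist1_plaqHol_iter_gaugeAct (F := F) (N := N) (K := K) (by omega : m ≤ (F.P K).m + (F.P K).K) (blockLift (m + 1) h) (gaugeAct w U) q
    have h2 := dist1_plaqHol_iter_gaugeAct (F := F) (N := N) (K := K) (by omega : m ≤ (F.P K).m + (F.P K).K) w U q
    rw [hU'', h1, h2]
    exact hA q hq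
  have hrow := dist1_iter_within_le_of_box hk U'' htower ha hNm t hW b hsrc htgt
  rw [hid]
  exact (norm_mlog_le_two_mul (hrow.trans hr)).trans (mul_le_mul_of_nonneg_left hrow (by norm_num))

end Record

end Summit.QuantumFields.YangMills.BalabanUVNodes.N07DentRowsTwoBlocks

end
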